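import Mathlib
import Literature.Computability.AlgebraicComplexity.Apolarity
import Literature.Computability.AlgebraicComplexity.ApolarityAction
import Literature.Computability.AlgebraicComplexity.LinSubst
import Literature.Computability.AlgebraicComplexity.OrbitClosure
import Summits.ValiantsHypothesis.ValiantsHypothesis.Theorems.BorderApolarityFixedWitnessObstructionQPKuratowskiSubmodule
import Summits.ValiantsHypothesis.ValiantsHypothesis.Theorems.BorderApolarityFixedWitnessObstructionQPAnnSubmodule

/-!
# Border apolarity, crux `ToricFixedPoints` — cell approachability: generic cocharacters and the interior case

Route `ValiantsHypothesis/BorderApolarity`, crux item `stmt-ValiantsHypothesis-5779`, line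
`bb-cell-state-polytope`, stub `stub_cellApproachable` (S2), helper file 1 — two unconditional
sub-results of the stub:

* `cellApproachable_exists_generic` — **existence of a generic cocharacter.**  If the `J k`, `k ≤ m`,
  contain `0` and are closed under addition, the weight vectors `μ : Fin m × Fin m → ℤ` grading `J`
  (`∀ k ≤ m, ∀ D ∈ J k, ∀ ν, weightedHomogeneousComponent μ ν D ∈ J k`) form a subgroup `L(J)`
  (components for `μ₁ + μ₂` are finite sums of iterated components), and some `μ ∈ L(J)` is
  GENERIC: it separates every pair of exponents of the same degree `k ≤ m` that some `μ₁ ∈ L(J)`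
  separates (finitely many pairs; accumulate `μ ↦ N • μ + μ_q`, `N` larger than all
  `|⟨μ_q, e - e'⟩|`).  `…_of_isBorderApolarLimit`: this applies to every border-apolarity limit.
* `cellApproachable_interior` — **the interior case.**  If `J k = Ann_k(P₀)`, `k ≤ m`, for one
  `P₀ ∈ GL · det_m`, the conclusion of the stub holds with `P' t := P₀`: `Ann_k(P₀)` is a
  finite-dimensional subspace, hence closed under coefficientwise limits, so the constant sequence
  has Kuratowski limit `(Ann_k(P₀))_k`, and the filtration ranks agree trivially.
-/

open MvPolynomial Filter
open scoped BigOperators Matrix Topology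
open Literature.Computability.AlgebraicComplexity

set_option linter.dupNamespace false

namespace Summit.ValiantsHypothesis.ValiantsHypothesis.Theorems.BorderApolarityToricFixedPoints

open Summit.ValiantsHypothesis.ValiantsHypothesis.Theorems.BorderApolarityFixedWitnessObstructionQP

/-! ## Weights are additive in the weight vector -/

section Weights

variable {σ : Type*}

/-- `⟨w₁ + w₂, e⟩ = ⟨w₁, e⟩ + ⟨w₂, e⟩`. [folklore] -/
theorem ca_weight_add (w₁ w₂ : σ → ℤ) (e : σ →₀ ℕ) :
    Finsupp.weight (w₁ + w₂) e = Finsupp.weight w₁ e + Finsupp.weight w₂ e := by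
  simp only [Finsupp.weight_apply, Finsupp.sum, Pi.add_apply, smul_add, Finset.sum_add_distrib]

/-- `⟨-w, e⟩ = -⟨w, e⟩`. [folklore] -/
theorem ca_weight_neg (w : σ → ℤ) (e : σ →₀ ℕ) :
    Finsupp.weight (-w) e = -Finsupp.weight w e := by
  simp only [Finsupp.weight_apply, Finsupp.sum, Pi.neg_apply, smul_neg, Finset.sum_neg_distrib]

/-- `⟨N • w, e⟩ = N • ⟨w, e⟩` for `N : ℕ`. [folklore] -/
theorem ca_weight_nsmul (N : ℕ) (w : σ → ℤ) (e : σ →₀ ℕ) :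
    Finsupp.weight (N • w) e = N • Finsupp.weight w e := by
  simp only [Finsupp.weight_apply, Finsupp.sum, Pi.smul_apply, Finset.smul_sum]
  exact Finset.sum_congr rfl fun i _ => smul_comm (e i) N (w i)

/-- The weight of the zero weight vector vanishes. [folklore] -/
theorem ca_weight_zero (e : σ →₀ ℕ) : Finsupp.weight (0 : σ → ℤ) e = 0 := by
  simp only [Finsupp.weight_apply, Finsupp.sum, Pi.zero_apply, smul_zero, Finset.sum_const_zero]

/-! ## Weighted homogeneous components for `-w`, `0` and `w₁ + w₂` -/

variable {R : Type*} [CommSemiring R]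

/-- Components for the opposite weight: `D_{-w, ν} = D_{w, -ν}`. [folklore] -/
theorem ca_weightedHomogeneousComponent_neg (w : σ → ℤ) (ν : ℤ) (D : MvPolynomial σ R) :
    weightedHomogeneousComponent (-w) ν D = weightedHomogeneousComponent w (-ν) D := by
  classical
  ext d
  simp only [coeff_weightedHomogeneousComponent, ca_weight_neg, neg_eq_iff_eq_neg]

/-- Components for the zero weight: `D_{0,0} = D`. [folklore] -/
theorem ca_weightedHomogeneousComponent_zero_zero (D : MvPolynomial σ R) :
    weightedHomogeneousComponent (0 : σ → ℤ) 0 D = D := by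
  classical
  ext d
  rw [coeff_weightedHomogeneousComponent, if_pos (ca_weight_zero d)]

/-- Components for the zero weight: `D_{0,ν} = 0` for `ν ≠ 0`. [folklore] -/
theorem ca_weightedHomogeneousComponent_zero_of_ne {ν : ℤ} (hν : ν ≠ 0) (D : MvPolynomial σ R) :
    weightedHomogeneousComponent (0 : σ → ℤ) ν D = 0 := by
  classical
  ext d
  rw [coeff_weightedHomogeneousComponent, if_neg, coeff_zero]
  rw [ca_weight_zero]
  exact Ne.symm hν

/-- **Components for a sum of weights** are finite sums of iterated components:
`D_{w₁+w₂, ν} = Σ_{ν₁} (D_{w₂, ν-ν₁})_{w₁, ν₁}`, the sum over the `w₁`-weights of the support of `D`.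
[folklore] -/
theorem ca_weightedHomogeneousComponent_add [DecidableEq σ] (w₁ w₂ : σ → ℤ) (ν : ℤ)
    (D : MvPolynomial σ R) :
    weightedHomogeneousComponent (w₁ + w₂) ν D =
      ∑ ν₁ ∈ D.support.image (Finsupp.weight w₁),
        weightedHomogeneousComponent w₁ ν₁ (weightedHomogeneousComponent w₂ (ν - ν₁) D) := by
  classical
  ext d
  rw [coeff_sum]
  simp only [coeff_weightedHomogeneousComponent, ca_weight_add]
  by_cases hd : d ∈ D.support
  · rw [Finset.sum_eq_single (Finsupp.weight w₁ d)]
    · rw [if_pos rfl]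
      by_cases h : Finsupp.weight w₁ d + Finsupp.weight w₂ d = ν
      · rw [if_pos h, if_pos (by omega)]
      · rw [if_neg h, if_neg (by omega)]
    · intro ν₁ _ hne
      rw [if_neg (Ne.symm hne)]
    · intro hnot
      exact absurd (Finset.mem_image_of_mem _ hd) hnot
  · rw [notMem_support_iff] at hd
    simp [hd]

end Weights

/-! ## The lattice `L(J)` of gradings -/

section Gradings

variable {σ : Type*} (m : ℕ) (J : ℕ → Set (MvPolynomial σ ℂ))

/-- The zero weight grades every family containing `0` in degrees `≤ m`. [folklore] -/
theorem ca_grading_zero (h0 : ∀ k ≤ m, (0 : MvPolynomial σ ℂ) ∈ J k) :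
    ∀ k ≤ m, ∀ D ∈ J k, ∀ ν : ℤ, weightedHomogeneousComponent (0 : σ → ℤ) ν D ∈ J k := by
  intro k hk D hD ν
  by_cases hν : ν = 0
  · subst hν
    rw [ca_weightedHomogeneousComponent_zero_zero]
    exact hD
  · rw [ca_weightedHomogeneousComponent_zero_of_ne hν]
    exact h0 k hk

variable {m J}

/-- `L(J)` is closed under negation. [folklore] -/
theorem ca_grading_neg {μ : σ → ℤ}
    (hμ : ∀ k ≤ m, ∀ D ∈ J k, ∀ ν : ℤ, weightedHomogeneousComponent μ ν D ∈ J k) :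
    ∀ k ≤ m, ∀ D ∈ J k, ∀ ν : ℤ, weightedHomogeneousComponent (-μ) ν D ∈ J k := by
  intro k hk D hD ν
  rw [ca_weightedHomogeneousComponent_neg]
  exact hμ k hk D hD (-ν)

/-- `L(J)` is closed under addition when the `J k`, `k ≤ m`, contain `0` and are closed under
addition (the projections `D ↦ D_{μ₁,ν₁}` and `D ↦ D_{μ₂,ν₂}` commute). [folklore] -/
theorem ca_grading_add (h0 : ∀ k ≤ m, (0 : MvPolynomial σ ℂ) ∈ J k)
    (hadd : ∀ k ≤ m, ∀ D ∈ J k, ∀ E ∈ J k, D + E ∈ J k) {μ₁ μ₂ : σ → ℤ}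
    (hμ₁ : ∀ k ≤ m, ∀ D ∈ J k, ∀ ν : ℤ, weightedHomogeneousComponent μ₁ ν D ∈ J k)
    (hμ₂ : ∀ k ≤ m, ∀ D ∈ J k, ∀ ν : ℤ, weightedHomogeneousComponent μ₂ ν D ∈ J k) :
    ∀ k ≤ m, ∀ D ∈ J k, ∀ ν : ℤ, weightedHomogeneousComponent (μ₁ + μ₂) ν D ∈ J k := by
  classical
  intro k hk D hD ν
  rw [ca_weightedHomogeneousComponent_add]
  refine Finset.sum_induction _ (fun E => E ∈ J k) (fun a b ha hb => hadd k hk a ha b hb)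
    (h0 k hk) ?_
  intro ν₁ _
  exact hμ₁ k hk _ (hμ₂ k hk D hD _) ν₁

/-- `L(J)` is closed under natural multiples. [folklore] -/
theorem ca_grading_nsmul (h0 : ∀ k ≤ m, (0 : MvPolynomial σ ℂ) ∈ J k)
    (hadd : ∀ k ≤ m, ∀ D ∈ J k, ∀ E ∈ J k, D + E ∈ J k) {μ : σ → ℤ}
    (hμ : ∀ k ≤ m, ∀ D ∈ J k, ∀ ν : ℤ, weightedHomogeneousComponent μ ν D ∈ J k) (N : ℕ) :
    ∀ k ≤ m, ∀ D ∈ J k, ∀ ν : ℤ, weightedHomogeneousComponent (N • μ) ν D ∈ J k := by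
  induction N with
  | zero =>
    rw [zero_smul]
    exact ca_grading_zero m J h0
  | succ N ih =>
    rw [succ_nsmul]
    exact ca_grading_add h0 hadd ih hμ

/-- **Simultaneous separation.**  If every pair in a finite set `S` of pairs of exponents is
separated by some grading of `J`, one grading separates them all: accumulate `μ ↦ N • μ + μ_q`
with `N` exceeding every `|⟨μ_q, e⟩ - ⟨μ_q, e'⟩|`, `(e, e') ∈ S`. [folklore] -/
theorem ca_exists_separating (h0 : ∀ k ≤ m, (0 : MvPolynomial σ ℂ) ∈ J k)
    (hadd : ∀ k ≤ m, ∀ D ∈ J k, ∀ E ∈ J k, D + E ∈ J k)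
    (S : Finset ((σ →₀ ℕ) × (σ →₀ ℕ)))
    (hS : ∀ p ∈ S, ∃ μ₁ : σ → ℤ,
      (∀ k ≤ m, ∀ D ∈ J k, ∀ ν : ℤ, weightedHomogeneousComponent μ₁ ν D ∈ J k) ∧
        Finsupp.weight μ₁ p.1 ≠ Finsupp.weight μ₁ p.2) :
    ∃ μ : σ → ℤ, (∀ k ≤ m, ∀ D ∈ J k, ∀ ν : ℤ, weightedHomogeneousComponent μ ν D ∈ J k) ∧
      ∀ p ∈ S, Finsupp.weight μ p.1 ≠ Finsupp.weight μ p.2 := by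
  classical
  induction S using Finset.induction_on with
  | empty => exact ⟨0, ca_grading_zero m J h0, by simp⟩
  | insert q S hqS ih =>
    obtain ⟨μ, hμ, hsep⟩ := ih fun p hp => hS p (Finset.mem_insert_of_mem hp)
    obtain ⟨μq, hμq, hq⟩ := hS q (Finset.mem_insert_self q S)
    set N : ℕ := 1 + ∑ a ∈ insert q S,
      (Finsupp.weight μq a.1 - Finsupp.weight μq a.2).natAbs with hN
    refine ⟨N • μ + μq, ca_grading_add h0 hadd (ca_grading_nsmul h0 hadd hμ N) hμq, ?_⟩
    intro a ha
    rw [ca_weight_add, ca_weight_add, ca_weight_nsmul, ca_weight_nsmul, nsmul_eq_mul, nsmul_eq_mul]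
    have hbound : (Finsupp.weight μq a.1 - Finsupp.weight μq a.2).natAbs < N := by
      have h := Finset.single_le_sum (f := fun a : (σ →₀ ℕ) × (σ →₀ ℕ) =>
        (Finsupp.weight μq a.1 - Finsupp.weight μq a.2).natAbs) (fun _ _ => Nat.zero_le _) ha
      omega
    have hbound' : |Finsupp.weight μq a.1 - Finsupp.weight μq a.2| < (N : ℤ) := by
      rw [← Int.natCast_natAbs]
      exact_mod_cast hbound
    by_cases hzero : Finsupp.weight μ a.1 = Finsupp.weight μ a.2
    · -- only `a = q` can be unseparated by `μ`
      have haq : a = q := by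
        rcases Finset.mem_insert.1 ha with h | h
        · exact h
        · exact absurd hzero (hsep a h)
      subst haq
      rw [hzero]
      intro h
      exact hq (add_left_cancel h)
    · intro h
      have key : (N : ℤ) * (Finsupp.weight μ a.1 - Finsupp.weight μ a.2) =
          -(Finsupp.weight μq a.1 - Finsupp.weight μq a.2) := by
        linear_combination h
      have h1 : (N : ℤ) ≤ |(N : ℤ) * (Finsupp.weight μ a.1 - Finsupp.weight μ a.2)| := by
        rw [abs_mul, Nat.abs_cast]
        exact le_mul_of_one_le_right (by positivity) (Int.one_le_abs (sub_ne_zero.2 hzero))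
      rw [key, abs_neg] at h1
      exact absurd hbound' (not_lt.2 h1)

end Gradings

/-! ## (a) Existence of a generic cocharacter -/

/-- **EXISTENCE OF A GENERIC COCHARACTER.**  For every family `J` of sets of polynomials in the
`m²` variables whose members in degrees `≤ m` contain `0` and are closed under addition, some weight
vector `μ : Fin m × Fin m → ℤ` grades `J` in degrees `≤ m` and is generic for `J`: it separates every
pair of exponents of the same degree `k ≤ m` that is separated by some weight vector grading `J`.
(The gradings form a subgroup `L(J)` of `ℤ^{m²}`; there are finitely many such pairs; a finitely
generated free abelian group is not a finite union of kernels of nonzero functionals.)  This is the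
first conjunct of the conclusion of `stub_cellApproachable`. [folklore] -/
theorem cellApproachable_exists_generic :
    ∀ (m : ℕ) (J : ℕ → Set (MvPolynomial (Fin m × Fin m) ℂ)),
      (∀ k ≤ m, (0 : MvPolynomial (Fin m × Fin m) ℂ) ∈ J k) →
      (∀ k ≤ m, ∀ D ∈ J k, ∀ E ∈ J k, D + E ∈ J k) →
      ∃ μ : Fin m × Fin m → ℤ,
        (∀ k ≤ m, ∀ D ∈ J k, ∀ ν : ℤ, weightedHomogeneousComponent μ ν D ∈ J k) ∧
          ∀ μ₁ : Fin m × Fin m → ℤ,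
            (∀ k ≤ m, ∀ D ∈ J k, ∀ ν : ℤ, weightedHomogeneousComponent μ₁ ν D ∈ J k) →
              ∀ k ≤ m, ∀ e e' : (Fin m × Fin m) →₀ ℕ, e.degree = k → e'.degree = k →
                Finsupp.weight μ₁ e ≠ Finsupp.weight μ₁ e' →
                  Finsupp.weight μ e ≠ Finsupp.weight μ e' := by
  intro m J h0 hadd
  classical
  -- the exponents of degree `≤ m`, a finite set
  set E : Finset ((Fin m × Fin m) →₀ ℕ) :=
    (Finset.range (m + 1)).biUnion fun k => (Finset.univ : Finset (Fin m × Fin m)).finsuppAntidiag k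
    with hE
  have hmemE : ∀ (k : ℕ), k ≤ m → ∀ e : (Fin m × Fin m) →₀ ℕ, e.degree = k → e ∈ E := by
    intro k hk e he
    rw [hE, Finset.mem_biUnion]
    refine ⟨k, Finset.mem_range.2 (Nat.lt_succ_of_le hk), ?_⟩
    rw [Finset.mem_finsuppAntidiag]
    refine ⟨?_, Finset.subset_univ _⟩
    rw [← he, Finsupp.degree_eq_sum]
  -- the separated pairs among them
  set S : Finset (((Fin m × Fin m) →₀ ℕ) × ((Fin m × Fin m) →₀ ℕ)) :=
    (E ×ˢ E).filter fun p => ∃ μ₁ : Fin m × Fin m → ℤ,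
      (∀ k ≤ m, ∀ D ∈ J k, ∀ ν : ℤ, weightedHomogeneousComponent μ₁ ν D ∈ J k) ∧
        Finsupp.weight μ₁ p.1 ≠ Finsupp.weight μ₁ p.2 with hS
  obtain ⟨μ, hμ, hsep⟩ := ca_exists_separating (m := m) (J := J) h0 hadd S
    fun p hp => (Finset.mem_filter.1 hp).2
  refine ⟨μ, hμ, fun μ₁ hμ₁ k hk e e' he he' hne => hsep (e, e') ?_⟩
  rw [hS, Finset.mem_filter, Finset.mem_product]
  exact ⟨⟨hmemE k hk e he, hmemE k hk e' he'⟩, μ₁, hμ₁, hne⟩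

/-- **Border-apolarity limits admit generic cocharacters.**  If `J` is the degree-wise Kuratowski
limit of the annihilators of any sequence of polynomials (`IsBorderApolarLimit m P J`), then each
`J k`, `k ≤ m`, is a linear subspace (`exists_submodule_coe_eq` applied to the annihilator subspaces
`exists_annSubmodule`), so `cellApproachable_exists_generic` applies: some weight vector grades `J` in
degrees `≤ m` and is generic for `J` — the first conjunct of the conclusion of `stub_cellApproachable`,
unconditionally. [folklore] -/
theorem cellApproachable_exists_generic_of_isBorderApolarLimit :
    ∀ (m : ℕ) (P : ℕ → MvPolynomial (Fin m × Fin m) ℂ) (J : ℕ → Set (MvPolynomial (Fin m × Fin m) ℂ)),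
      IsBorderApolarLimit m P J →
      ∃ μ : Fin m × Fin m → ℤ,
        (∀ k ≤ m, ∀ D ∈ J k, ∀ ν : ℤ, weightedHomogeneousComponent μ ν D ∈ J k) ∧
          ∀ μ₁ : Fin m × Fin m → ℤ,
            (∀ k ≤ m, ∀ D ∈ J k, ∀ ν : ℤ, weightedHomogeneousComponent μ₁ ν D ∈ J k) →
              ∀ k ≤ m, ∀ e e' : (Fin m × Fin m) →₀ ℕ, e.degree = k → e'.degree = k →
                Finsupp.weight μ₁ e ≠ Finsupp.weight μ₁ e' →
                  Finsupp.weight μ e ≠ Finsupp.weight μ e' := by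
  intro m P J hJ
  -- each `J k`, `k ≤ m`, is (the carrier of) a submodule
  have hsub : ∀ k ≤ m, ∃ Lk : Submodule ℂ (MvPolynomial (Fin m × Fin m) ℂ),
      (Lk : Set (MvPolynomial (Fin m × Fin m) ℂ)) = J k := by
    intro k hk
    have hA : ∀ t, ∃ A : Submodule ℂ (MvPolynomial (Fin m × Fin m) ℂ),
        (A : Set (MvPolynomial (Fin m × Fin m) ℂ)) = annihilatorOfDegree (P t) k := fun t => by
      obtain ⟨A, hA, -, -⟩ := exists_annSubmodule k (P t)
      exact ⟨A, hA⟩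
    choose A hA using hA
    refine exists_submodule_coe_eq A (J k) (fun D hD => ?_) (fun D φ Ds hφ hDs hlim => ?_)
    · obtain ⟨Ds, hDs, hlim⟩ := hJ.exists_tendsto hk hD
      exact ⟨Ds, fun t => by rw [← SetLike.mem_coe, hA]; exact hDs t, hlim⟩
    · exact hJ.mem_of_tendsto hk hφ (fun t => by rw [← hA, SetLike.mem_coe]; exact hDs t) hlim
  refine cellApproachable_exists_generic m J (fun k hk => hJ.zero_mem hk) fun k hk D hD E hE => ?_
  obtain ⟨Lk, hLk⟩ := hsub k hk
  rw [← hLk, SetLike.mem_coe] at hD hE ⊢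
  exact Lk.add_mem hD hE

/-! ## (b) The interior case -/

section Interior

variable {σ : Type*}

/-- **Finite-dimensional subspaces are closed under coefficientwise limits.**  If `A` is a
finite-dimensional subspace of `MvPolynomial σ ℂ`, `D_t ∈ A` and `coeffVec D_t → coeffVec D` in the
product topology, then `D ∈ A`: the image of `A` under the (injective, linear) coefficient map is a
finite-dimensional, hence closed, subspace of the Hausdorff topological vector space
`(σ →₀ ℕ) → ℂ`. [folklore] -/
theorem ca_mem_of_tendsto_coeffVec (A : Submodule ℂ (MvPolynomial σ ℂ)) [FiniteDimensional ℂ A]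
    {D : MvPolynomial σ ℂ} {Ds : ℕ → MvPolynomial σ ℂ} (hDs : ∀ t, Ds t ∈ A)
    (hlim : Tendsto (fun t => coeffVec (Ds t)) atTop (nhds (coeffVec D))) : D ∈ A := by
  -- the coefficient map as a linear map
  let π : MvPolynomial σ ℂ →ₗ[ℂ] ((σ →₀ ℕ) → ℂ) := LinearMap.pi fun d => lcoeff ℂ d
  have hπ : ∀ f, π f = coeffVec f := fun f => rfl
  have hclosed : IsClosed ((A.map π : Submodule ℂ ((σ →₀ ℕ) → ℂ)) : Set ((σ →₀ ℕ) → ℂ)) :=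
    (A.map π).closed_of_finiteDimensional
  have hmem : coeffVec D ∈ (A.map π : Set ((σ →₀ ℕ) → ℂ)) :=
    hclosed.mem_of_tendsto hlim
      (Eventually.of_forall fun t => ⟨Ds t, hDs t, hπ (Ds t)⟩)
  obtain ⟨D', hD', hD'eq⟩ := hmem
  rw [hπ] at hD'eq
  rw [← coeffVec_injective hD'eq]
  exact hD'

/-- **The constant sequence.**  For every polynomial `P₀` in finitely many variables the constant
sequence `t ↦ P₀` has border-apolarity limit `(Ann_k(P₀))_k` in every range of degrees: (Li) with
constant approximants, (Ls) because `Ann_k(P₀)` is a finite-dimensional subspace of the degree-`k`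
forms (`exists_annSubmodule`), closed under coefficientwise limits. [folklore] -/
theorem ca_isBorderApolarLimit_const [Fintype σ] (d : ℕ) (P₀ : MvPolynomial σ ℂ) :
    IsBorderApolarLimit d (fun _ : ℕ => P₀) (fun k => annihilatorOfDegree P₀ k) := by
  classical
  refine ⟨fun k _ D hD => ⟨fun _ => D, fun _ => hD, tendsto_const_nhds⟩, ?_⟩
  intro k _ D φ Ds _ hDs hlim
  obtain ⟨A, hA, hAle, -⟩ := exists_annSubmodule k P₀
  haveI : Module.Finite ℂ (homogeneousSubmodule σ ℂ k) :=
    Module.Finite.iff_fg.2 (homogeneousSubmodule_fg σ ℂ k)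
  haveI : FiniteDimensional ℂ A := Submodule.finiteDimensional_of_le hAle
  have hDsA : ∀ t, Ds t ∈ A := fun t => by
    rw [← SetLike.mem_coe, hA]
    exact hDs t
  have hDA : D ∈ A := ca_mem_of_tendsto_coeffVec A hDsA hlim
  rw [← SetLike.mem_coe, hA] at hDA
  exact hDA

end Interior

/-- **THE INTERIOR CASE of `stub_cellApproachable`.**  If `J k = Ann_k(P₀)` for all `k ≤ m` and one
`P₀ ∈ GL · det_m` (a point of the orbit `O`), then the conclusion of the stub holds: a generic
cocharacter grading `J` exists (`cellApproachable_exists_generic`; each `Ann_k(P₀)` contains `0` and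
is closed under addition), and the constant orbit sequence `P' t := P₀` has border-apolarity limit
`J` (`ca_isBorderApolarLimit_const`) with, trivially, the same filtration ranks as `J`. [folklore] -/
theorem cellApproachable_interior :
    ∀ (m : ℕ) (J : ℕ → Set (MvPolynomial (Fin m × Fin m) ℂ)) (P₀ : MvPolynomial (Fin m × Fin m) ℂ),
      P₀ ∈ glOrbit (Fin m × Fin m) ℂ (detPoly (Fin m) ℂ) →
      (∀ k ≤ m, J k = annihilatorOfDegree P₀ k) →
      ∃ (μ : Fin m × Fin m → ℤ) (P' : ℕ → MvPolynomial (Fin m × Fin m) ℂ),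
        ((∀ k ≤ m, ∀ D ∈ J k, ∀ ν : ℤ, weightedHomogeneousComponent μ ν D ∈ J k) ∧
          ∀ μ₁ : Fin m × Fin m → ℤ,
            (∀ k ≤ m, ∀ D ∈ J k, ∀ ν : ℤ, weightedHomogeneousComponent μ₁ ν D ∈ J k) →
              ∀ k ≤ m, ∀ e e' : (Fin m × Fin m) →₀ ℕ, e.degree = k → e'.degree = k →
                Finsupp.weight μ₁ e ≠ Finsupp.weight μ₁ e' →
                  Finsupp.weight μ e ≠ Finsupp.weight μ e') ∧
        (∀ t : ℕ, P' t ∈ glOrbit (Fin m × Fin m) ℂ (detPoly (Fin m) ℂ)) ∧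
        IsBorderApolarLimit m P' J ∧
        (∀ t : ℕ, ∀ k ≤ m, ∀ ν : ℤ,
          Module.finrank ℂ ↥(Submodule.span ℂ (annihilatorOfDegree (P' t) k ∩
            {D : MvPolynomial (Fin m × Fin m) ℂ | ∀ e ∈ D.support, ν ≤ Finsupp.weight μ e})) =
          Module.finrank ℂ ↥(Submodule.span ℂ (J k ∩
            {D : MvPolynomial (Fin m × Fin m) ℂ | ∀ e ∈ D.support, ν ≤ Finsupp.weight μ e}))) := by
  intro m J P₀ hP₀ hJ
  have h0 : ∀ k ≤ m, (0 : MvPolynomial (Fin m × Fin m) ℂ) ∈ J k := fun k hk => by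
    rw [hJ k hk]
    exact zero_mem_annihilatorOfDegree P₀ k
  have hadd : ∀ k ≤ m, ∀ D ∈ J k, ∀ E ∈ J k, D + E ∈ J k := fun k hk D hD E hE => by
    rw [hJ k hk] at hD hE ⊢
    exact ⟨hD.1.add hE.1, by rw [apolarAction_add_left, hD.2, hE.2, add_zero]⟩
  obtain ⟨μ, hμ⟩ := cellApproachable_exists_generic m J h0 hadd
  refine ⟨μ, fun _ => P₀, hμ, fun _ => hP₀, ?_, ?_⟩
  · -- the constant sequence converges to its own annihilator system, which is `J` in degrees `≤ m`
    have h := ca_isBorderApolarLimit_const m P₀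
    refine ⟨fun k hk D hD => ?_, fun k hk D φ Ds hφ hDs hlim => ?_⟩
    · rw [hJ k hk] at hD
      exact h.1 k hk D hD
    · rw [hJ k hk]
      exact h.2 k hk D φ Ds hφ hDs hlim
  · intro t k hk ν
    rw [hJ k hk]

end Summit.ValiantsHypothesis.ValiantsHypothesis.Theorems.BorderApolarityToricFixedPoints
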